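import Literature.NumberTheory.GaloisRepresentations.GaloisCohomologyKummerProofs
import Literature.NumberTheory.GaloisRepresentations.ContinuousH1ResCocycle
import Literature.NumberTheory.GaloisRepresentations.LocalGlobalCohomologyTateProofs
import HarnessLib

/-!
# Kummer theory commutes with restriction: `res (δ_K a) = δ_L a` in `H¹(L, μₙ)`

For a field extension `L/K` (`n` invertible in `K`) the tree's restriction map
`galoisCohomology.res (mu K n) L 1 : H¹(K, μₙ(K̄)) → H¹(Γ_L, μₙ(K̄)|_{Γ_L})` keeps the coefficients
`μₙ(K̄)`, with `Γ_L` acting through the fixed restriction `absGaloisRestrict K L : Γ_L → Γ_K` (a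
choice of embedding `ι = absClosureEmbedding K L : K̄ → L̄`). Kummer theory over `L`
(`kummerMap L n : Lˣ → H¹(L, μₙ(L̄))`, `kummerEquiv L n`) lives on `μₙ(L̄)`. This file supplies the
change of coefficients and proves that the Kummer map is natural for restriction:

* the tree's change of coefficients `muTransfer K L n : μₙ(K̄) →+ μₙ(L̄)`, `ζ ↦ ι ζ`
  (`LocalGlobalCohomologyTateProofs.lean`; `Γ_L`-equivariant by `muTransfer_mu`), as an
  intertwining map `(mu K n).restrictField L → mu L n` (`muTransferIntertwining`) and a map on
  cohomology `muTransferH1 : H¹(Γ_L, μₙ(K̄)|_{Γ_L}) →+ H¹(L, μₙ(L̄))`;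
* `resMu K L n : H¹(K, μₙ) →+ H¹(L, μₙ)` — the composite "restrict, then change coefficients",
  computed on explicit cocycles (`resMu_oneCocycleClass`: `[φ] ↦ [σ ↦ ι(φ(σ|_{K̄}))]`);
* **`resMu_kummerMap`**: `resMu K L n (δ_K a) = δ_L (a)` for `a ∈ Kˣ` — the Kummer cocycle
  `σ ↦ σ(ⁿ√a)/ⁿ√a` of `K` restricted to `Γ_L` and read in `L̄` is the Kummer cocycle of the root
  `ι(ⁿ√a)` of `a ∈ Lˣ` (Serre, *Galois Cohomology*, II §1.2: the connecting homomorphisms of the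
  Kummer sequences over `K` and over `L` are compatible with restriction), and with the Kummer
  isomorphisms: `kummerEquiv_resMu`: `kummerEquiv L n (resMu (c)) = ` the image in `Lˣ/Lˣⁿ` of
  `kummerEquiv K n c` (the natural map `Kˣ/Kˣⁿ → Lˣ/Lˣⁿ`).

Consumer: the descent–Selmer bridge (`EllipticCurves/TwoDescentKummerBridge.lean`) at a completion
`L = K_v`: the `T₁`-component of a class of `H¹(K, E[2])` restricted to `Γ_{K_v}` is the image of its
global component in `K_vˣ/K_vˣ²`. Definitions with bodies and theorems only; no named fact.

## References

* [SerreGaloisCohomology1997] J.-P. Serre, *Galois Cohomology*, Springer 1997, I §2.4 (restriction,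
  compatible pairs), II §1.2 (Kummer theory).
* [Serre1979] J.-P. Serre, *Local Fields*, GTM 67, Ch. X §3.
-/

noncomputable section

open Field

universe u

namespace Literature.NumberTheory.GaloisRepresentations

open DiscreteGaloisModule

variable (K L : Type u) [Field K] [Field L] [Algebra K L] (n : ℕ)

/-! ### The change of coefficients `μₙ(K̄) → μₙ(L̄)` on cohomology -/

/-- The change of coefficients as a continuous intertwining map
`(mu K n).restrictField L → mu L n` (Mathlib `ContIntertwiningMap`).
[cite: SerreGaloisCohomology1997, I §2.4] -/
def muTransferIntertwining :
    ContIntertwiningMap ((mu K n).restrictField L).toContRepresentation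
      (mu L n).toContRepresentation where
  toLinearMap := (muTransfer K L n).toIntLinearMap
  cont := continuous_of_discreteTopology
  isIntertwining' σ := by
    ext ζ
    exact muTransfer_mu K L n σ ζ

/-- The map `H¹(Γ_L, μₙ(K̄)|_{Γ_L}) →+ H¹(L, μₙ(L̄))` induced by the change of coefficients.
[cite: SerreGaloisCohomology1997, I §2.4] -/
def muTransferH1 : galoisCohomology ((mu K n).restrictField L) 1 →+ galoisCohomology (mu L n) 1 :=
  galoisCohomology.map (muTransferIntertwining K L n) 1

/-- **Restriction for `μₙ` with the change of closures**:
`resMu : H¹(K, μₙ(K̄)) →+ H¹(L, μₙ(L̄))`, restrict along `Γ_L → Γ_K` then push the coefficients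
along `ι : K̄ → L̄`. [cite: SerreGaloisCohomology1997, I §2.4] -/
def resMu : galoisCohomology (mu K n) 1 →+ galoisCohomology (mu L n) 1 :=
  (muTransferH1 K L n).comp (galoisCohomology.res (mu K n) L 1)

/-- `muTransferH1` on explicit cocycles: `[ψ] ↦ [ι ∘ ψ]`. [cite: SerreGaloisCohomology1997, I §2.4] -/
theorem muTransferH1_oneCocycleClass
    (ψ : contOneCocycles (DiscreteGaloisModule.toTopRep ((mu K n).restrictField L))) :
    muTransferH1 K L n (oneCocycleClass _ ψ) =
      oneCocycleClass _ (contOneCocycles.pullback (ContinuousMonoidHom.id (absoluteGaloisGroup L))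
        (TopRep.ofHom ⟨(muTransferIntertwining K L n).toContinuousLinearMap,
          (muTransferIntertwining K L n).isIntertwining'⟩) ψ) := by
  unfold muTransferH1 galoisCohomology.map
  exact map_oneCocycleClass _ (ContinuousMonoidHom.id (absoluteGaloisGroup L)) _ ψ

/-- **`resMu` on explicit cocycles**: `[φ] ↦ [σ ↦ ι(φ(σ|_{K̄}))]`.
[cite: SerreGaloisCohomology1997, I §2.4] -/
theorem resMu_oneCocycleClass (φ : contOneCocycles (mu K n).toTopRep) :
    resMu K L n (oneCocycleClass _ φ) =
      oneCocycleClass _ (contOneCocycles.pullback (ContinuousMonoidHom.id (absoluteGaloisGroup L))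
        (TopRep.ofHom ⟨(muTransferIntertwining K L n).toContinuousLinearMap,
          (muTransferIntertwining K L n).isIntertwining'⟩)
        (contOneCocycles.pullback (absGaloisRestrict K L)
          (TopRep.ofHom ⟨ContinuousLinearMap.id ℤ (MuCarrier K n), fun _ => rfl⟩ :
            TopRep.res (absGaloisRestrict K L : absoluteGaloisGroup L →* absoluteGaloisGroup K)
              (mu K n).toTopRep ⟶ DiscreteGaloisModule.toTopRep ((mu K n).restrictField L)) φ)) := by
  unfold resMu
  rw [AddMonoidHom.comp_apply, galoisCohomology.res_oneCocycleClass, muTransferH1_oneCocycleClass]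

/-- The value of the cocycle `resMu [φ]` at `σ`: `ι(φ(σ|_{K̄}))`, as a unit of `L̄`.
[cite: SerreGaloisCohomology1997, I §2.4] -/
theorem muVal_pullback_apply (φ : contOneCocycles (mu K n).toTopRep) (σ : absoluteGaloisGroup L) :
    muVal L n ((contOneCocycles.pullback (ContinuousMonoidHom.id (absoluteGaloisGroup L))
        (TopRep.ofHom ⟨(muTransferIntertwining K L n).toContinuousLinearMap,
          (muTransferIntertwining K L n).isIntertwining'⟩)
        (contOneCocycles.pullback (absGaloisRestrict K L)
          (TopRep.ofHom ⟨ContinuousLinearMap.id ℤ (MuCarrier K n), fun _ => rfl⟩ :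
            TopRep.res (absGaloisRestrict K L : absoluteGaloisGroup L →* absoluteGaloisGroup K)
              (mu K n).toTopRep ⟶ DiscreteGaloisModule.toTopRep ((mu K n).restrictField L)) φ)).1 σ) =
      Units.map (absClosureEmbedding K L : AlgebraicClosure K →* AlgebraicClosure L)
        (muVal K n (φ.1 (absGaloisRestrict K L σ))) :=
  rfl

/-! ### Kummer theory commutes with restriction -/

/-- The image under `ι : K̄ → L̄` of a Kummer unit of `K` is a Kummer unit of `L`: its `n`-th power
is the image of a `Γ_K`-fixed unit, hence `Γ_L`-fixed (`absGaloisRestrict_apply_smul`).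
[cite: SerreGaloisCohomology1997, II §1.2] -/
theorem map_mem_kummerUnits (α : kummerUnits K n) :
    Units.map (absClosureEmbedding K L : AlgebraicClosure K →* AlgebraicClosure L)
      (α : (AlgebraicClosure K)ˣ) ∈ kummerUnits L n := by
  intro σ
  rw [← map_pow]
  ext
  rw [Units.coe_smul, Units.coe_map, MonoidHom.coe_coe, ← absGaloisRestrict_apply_smul,
    ← Units.coe_smul, α.2 (absGaloisRestrict K L σ)]

/-- **Kummer classes are natural for restriction** (cocycle level): `resMu` sends the Kummer class
of a Kummer unit `α` of `K` to the Kummer class of `ι α`. [cite: SerreGaloisCohomology1997, II §1.2] -/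
theorem resMu_kummerClassHom (α : kummerUnits K n) :
    resMu K L n (kummerClassHom K n α).toAdd =
      (kummerClassHom L n ⟨_, map_mem_kummerUnits K L n α⟩).toAdd := by
  rw [kummerClassHom_apply, kummerClassHom_apply, toAdd_ofAdd, toAdd_ofAdd, resMu_oneCocycleClass]
  congr 1
  apply Subtype.ext
  ext σ : 1
  apply muVal_injective L n
  rw [muVal_pullback_apply, kummerOneCocycle_apply, kummerOneCocycle_apply,
    muVal_kummerOneCocycleFun, muVal_kummerOneCocycleFun, map_div]
  congr 1
  ext
  change absClosureEmbedding K L ((absGaloisRestrict K L σ • (α : (AlgebraicClosure K)ˣ)) :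
    AlgebraicClosure K) = σ • absClosureEmbedding K L (α : (AlgebraicClosure K)ˣ)
  exact absGaloisRestrict_apply_smul K L σ _

variable [NeZero (n : K)] [NeZero (n : L)]

omit [NeZero (n : L)] in
/-- The `n`-th power of the transported root: `(ι ⁿ√a)ⁿ = a` in `L̄`, via the scalar tower
`K → L → L̄` and the `K`-linearity of `ι`. [cite: SerreGaloisCohomology1997, II §1.2] -/
theorem map_kummerUnitsRoot_pow (a : Kˣ) :
    (Units.map (absClosureEmbedding K L : AlgebraicClosure K →* AlgebraicClosure L)
        (kummerUnitsRoot K n a : (AlgebraicClosure K)ˣ)) ^ n =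
      Units.map (algebraMap L (AlgebraicClosure L) : L →* AlgebraicClosure L)
        (Units.map (algebraMap K L : K →* L) a) := by
  rw [← map_pow, kummerUnitsRoot_pow]
  ext
  simp only [Units.coe_map, MonoidHom.coe_coe, AlgHom.commutes]
  exact IsScalarTower.algebraMap_apply K L (AlgebraicClosure L) (a : K)

/-- **Kummer theory commutes with restriction**: `res (δ_K a) = δ_L a` for `a ∈ Kˣ`, where
`δ = kummerMap` is the connecting homomorphism of the Kummer sequence and `res = resMu` restricts to
`Γ_L` and reads the coefficients in `L̄`. [cite: SerreGaloisCohomology1997, II §1.2, I §2.4] -/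
theorem resMu_kummerMap (a : Kˣ) :
    resMu K L n (kummerMap K n a).toAdd =
      (kummerMap L n (Units.map (algebraMap K L : K →* L) a)).toAdd := by
  rw [kummerMap_apply, resMu_kummerClassHom, kummerMap_apply]
  congr 1
  apply kummerClassHom_eq_of_pow_eq
  rw [kummerUnitsRoot_pow]
  exact map_kummerUnitsRoot_pow K L n a

/-- **Kummer theory commutes with restriction, on `Kˣ/Kˣⁿ`**: under the Kummer isomorphisms
`kummerEquiv`, `resMu` is the natural map `Kˣ/Kˣⁿ → Lˣ/Lˣⁿ` induced by `Units.map (algebraMap K L)`.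
[cite: SerreGaloisCohomology1997, II §1.2, I §2.4] -/
theorem kummerEquiv_resMu_symm (a : Kˣ) :
    kummerEquiv L n (resMu K L n ((kummerEquiv K n).symm (Additive.ofMul (QuotientGroup.mk a)))) =
      Additive.ofMul (QuotientGroup.mk (Units.map (algebraMap K L : K →* L) a)) := by
  have h : (kummerEquiv K n).symm (Additive.ofMul (QuotientGroup.mk a)) = (kummerMap K n a).toAdd := by
    rw [← kummerEquiv_kummerMap, AddEquiv.symm_apply_apply]
  rw [h, resMu_kummerMap, kummerEquiv_kummerMap]

end Literature.NumberTheory.GaloisRepresentations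

end
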